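import Summits.CriticalPhenomena.Ising3DConformalLimit.Theorems.ArmDressingArmDressingGlueInvSystems
import Literature.Probability.LatticeModels.RandomClusterFKG
import HarnessLib

/-!
# Route `ArmDressing`, crux `ArmDressingGlue` (stmt-CriticalPhenomena-15700):
# stub `stub_fkgReduction`

The FKG REDUCTION of the non-degeneracy clause `CrossLawPositive` (skeleton v3 of the line
`registered` of the crux `ArmDressingGlue`) to TWO-BALL POSITIVITY: if for every pair of disjoint
closed balls `A, B ⊂ ℝ³` of positive radius the critical FK-Ising connection probability
`Pr[A^δ ↔ B^δ]` stays `≥ c(A, B) > 0` as the mesh `δ → 0⁺`, then for every family of `n + n`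
generalised balls with non-zero radii the probability that the discretised inner member `i` is
connected to the outer member `n + i` for every `i < n` stays `≥ c > 0`.

Proof.
1. GEOMETRY (`exists_ball_subset_gball`, `exists_disjoint_closedBalls_subset_gball`): a generalised ball with
   non-zero radius contains an open ball (the closed ball contains its interior; the closed exterior
   `(B(c, -r))ᶜ` contains the unit ball around `c + (1 - r) e₀`), so each pair
   `(gball pᵢ, gball p_{n+i})` contains a pair of DISJOINT closed balls of a common positive radius.
2. MONOTONICITY: the CROSS law decreases when the probe sets shrink (`InvBook.Pr_mono_set`,
   `InvBook.cross_upward`; discs of generalised balls are finite or co-finite for `δ > 0`).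
3. FKG: at finite volume the CROSS event of the shrunken family is the intersection of the `n`
   increasing events `{A_i^δ ↔ B_i^δ}` (`PrL_cross_append_eq_measureReal_biInter`,
   `isUpperSet_connEvent_box`), so the FKG inequality of the wired random-cluster measure
   (`rcMeasure_fkg_holds`, iterated: `fkg_prod_measureReal_le_biInter`) bounds its probability
   below by the product of the two-ball probabilities; `L → ∞` (`InvBook.tendsto_PrL`) transfers
   the bound to `Pr` (`prod_Pr_two_le_Pr_cross`).
4. `Filter.eventually_all` over the finitely many pairs and `c := ∏ᵢ cᵢ`.

References: C. M. Fortuin, P. W. Kasteleyn, J. Ginibre, Comm. Math. Phys. 22 (1971) (FKG);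
G. Grimmett, *The Random-Cluster Model* (2006), Thm. 3.8 (FKG for `q ≥ 1`), Thm. 4.19
(thermodynamic limit); F. Camia, Y. Feng, arXiv:2411.01467, §3.2.2 (planar template).
-/

noncomputable section

namespace Summit.CriticalPhenomena.Ising3DConformalLimit.Cruxes.ArmDressingGlue.CrossPos

open Summit.CriticalPhenomena.Ising3DConformalLimit.Cruxes.ArmDressingGlue.Vocab
open Summit.CriticalPhenomena.Ising3DConformalLimit.Theses
open scoped Topology BigOperators
open Filter Set MeasureTheory Literature.Probability.LatticeModels Literature.Probability.Percolation
open Literature.Barriers.CriticalPhenomena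

local notation "E3" => EuclideanSpace ℝ (Fin 3)

/-! ### §1 Geometry: generalised balls contain small disjoint closed balls -/

/-- Every generalised ball with non-zero radius contains an open ball: for `r > 0` the closed ball
contains its interior; for `r < 0` the closed exterior `(B(c, -r))ᶜ` contains the unit ball around
the far point `c + (1 - r) e₀`. [folklore] -/
theorem exists_ball_subset_gball (P : E3 × ℝ) (hP : P.2 ≠ 0) :
    ∃ (x : E3) (ε : ℝ), 0 < ε ∧ Metric.ball x ε ⊆ gball P := by
  rcases lt_or_gt_of_ne hP with h | h
  · refine ⟨P.1 + EuclideanSpace.single 0 (1 - P.2), 1, one_pos, ?_⟩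
    rw [gball_of_not_pos (not_lt.2 h.le)]
    intro y hy
    rw [Metric.mem_ball] at hy
    rw [mem_compl_iff, Metric.mem_ball, not_lt]
    have hv : dist (P.1 + EuclideanSpace.single 0 (1 - P.2)) P.1 = 1 - P.2 := by
      rw [dist_eq_norm, add_sub_cancel_left, PiLp.norm_single, Real.norm_eq_abs,
        abs_of_pos (by linarith)]
    have htri := dist_triangle (P.1 + EuclideanSpace.single 0 (1 - P.2)) y P.1
    rw [dist_comm] at hy
    linarith
  · exact ⟨P.1, P.2, h, by rw [gball_of_pos h]; exact Metric.ball_subset_closedBall⟩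

/-- Two generalised balls with non-zero radii contain two DISJOINT closed balls of a common positive
radius (an open ball of `ℝ³` has two distinct points). [folklore] -/
theorem exists_disjoint_closedBalls_subset_gball (P Q : E3 × ℝ) (hP : P.2 ≠ 0) (hQ : Q.2 ≠ 0) :
    ∃ (a b : E3) (r : ℝ), 0 < r ∧ Metric.closedBall a r ⊆ gball P ∧
      Metric.closedBall b r ⊆ gball Q ∧ Disjoint (Metric.closedBall a r) (Metric.closedBall b r) := by
  obtain ⟨x, ε, hε, hx⟩ := exists_ball_subset_gball P hP
  obtain ⟨y, ε', hε', hy⟩ := exists_ball_subset_gball Q hQ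
  -- a point `b ≠ x` with `B(b, ε'/2) ⊆ B(y, ε')`
  obtain ⟨b, hbx, hb⟩ : ∃ b : E3, b ≠ x ∧ Metric.ball b (ε' / 2) ⊆ Metric.ball y ε' := by
    by_cases hxy : y = x
    · have h1 : dist (y + EuclideanSpace.single 0 (ε' / 4)) y = ε' / 4 := by
        rw [dist_eq_norm, add_sub_cancel_left, PiLp.norm_single, Real.norm_eq_abs,
          abs_of_pos (by linarith)]
      refine ⟨y + EuclideanSpace.single 0 (ε' / 4), fun h => ?_, fun z hz => ?_⟩
      · rw [h, ← hxy, dist_self] at h1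
        linarith
      · rw [Metric.mem_ball] at hz ⊢
        linarith [dist_triangle z (y + EuclideanSpace.single 0 (ε' / 4)) y]
    · exact ⟨y, hxy, Metric.ball_subset_ball (by linarith)⟩
  have hd : 0 < dist x b := dist_pos.2 hbx.symm
  set r : ℝ := min (ε / 2) (min (ε' / 4) (dist x b / 3)) with hr
  have hr1 : r ≤ ε / 2 := min_le_left _ _
  have hr2 : r ≤ ε' / 4 := (min_le_right _ _).trans (min_le_left _ _)
  have hr3 : r ≤ dist x b / 3 := (min_le_right _ _).trans (min_le_right _ _)
  refine ⟨x, b, r, ?_, ?_, ?_, ?_⟩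
  · rw [hr]; positivity
  · exact (Metric.closedBall_subset_ball (by linarith)).trans hx
  · exact (Metric.closedBall_subset_ball (by linarith)).trans (hb.trans hy)
  · exact Metric.closedBall_disjoint_closedBall (by linarith)

/-- Discretised generalised balls are finite or co-finite (`δ > 0`). [folklore] -/
theorem disc_gball_finite_or_cofinite {δ : ℝ} (hδ : 0 < δ) (P : E3 × ℝ) :
    (disc δ (gball P)).Finite ∨ (disc δ (gball P))ᶜ.Finite := by
  by_cases h : 0 < P.2
  · rw [gball_of_pos h]
    exact Or.inl (InvBook.finite_disc hδ Metric.isBounded_closedBall)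
  · rw [gball_of_not_pos h]
    exact Or.inr (InvBook.cofinite_disc_compl hδ Metric.isBounded_ball)

/-! ### §2 Increasing connection events and the iterated FKG inequality in the wired box -/

/-- The event "some vertex over `A` is joined to some vertex over `B` by an open path" of the box
`Λ_L` is increasing. [folklore] -/
theorem isUpperSet_connEvent_box (L : ℕ) (A B : Set (Site 3)) :
    IsUpperSet {ω : BondConfig (BoxV 3 L) |
      ∃ u v : BoxV 3 L, u.1 ∈ A ∧ v.1 ∈ B ∧ (openGraph ω).Reachable u v} := by
  rintro ω ω' hle ⟨u, v, hu, hv, huv⟩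
  exact ⟨u, v, hu, hv, huv.mono (SimpleGraph.fromEdgeSet_mono hle)⟩

/-- **Iterated FKG** for the wired critical FK-Ising box measure: finitely many increasing events
occur simultaneously with probability at least the product of their probabilities
(Fortuin–Kasteleyn–Ginibre; `rcMeasure_fkg_holds` with `p = 1 - e^{-2β_c} ∈ [0,1]`, `q = 2 ≥ 1`,
by induction on the index set). [cite: Grimmett2006, Thm. 3.8] -/
theorem fkg_prod_measureReal_le_biInter {ι : Type*} (L : ℕ) (s : Finset ι)
    (E : ι → Set (BondConfig (BoxV 3 L))) (hE : ∀ i ∈ s, IsUpperSet (E i)) :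
    ∏ i ∈ s, (μ L).real (E i) ≤ (μ L).real (⋂ i ∈ s, E i) := by
  -- adapted from `RadialChain.rcMeasure_real_biInter_ge_pow` (SAWScalingLimit, same tree)
  classical
  induction s using Finset.induction_on with
  | empty => simp
  | @insert a s ha ih =>
    have hup : IsUpperSet (⋂ i ∈ s, E i) :=
      isUpperSet_iInter₂ fun i hi => hE i (Finset.mem_insert_of_mem hi)
    have h1 := ih fun i hi => hE i (Finset.mem_insert_of_mem hi)
    have fkg : (μ L).real (E a) * (μ L).real (⋂ i ∈ s, E i) ≤
        (μ L).real (E a ∩ ⋂ i ∈ s, E i) :=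
      rcMeasure_fkg_holds (boxGraph 3 L) fkIsingParam_criticalBeta_mem_Icc (by norm_num)
        (boxBoundary 3 L) (hE a (Finset.mem_insert_self a s)) hup
    rw [Finset.prod_insert ha, Finset.set_biInter_insert]
    exact (mul_le_mul_of_nonneg_left h1 measureReal_nonneg).trans fkg

/-! ### §3 The CROSS law of an appended family versus the two-set connection laws -/

/-- The two-set connection law of the box is the probability of the connection event. [folklore] -/
theorem PrL_two_conn_eq_measureReal (L : ℕ) (A B : Set (Site 3)) :
    PrL 2 ![A, B] {R | R 0 1} L =
      (μ L).real {ω | ∃ u v : BoxV 3 L, u.1 ∈ A ∧ v.1 ∈ B ∧ (openGraph ω).Reachable u v} := rfl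

/-- The CROSS law of the appended family `A ++ B` in the box is the probability of the
intersection of the `n` connection events `{Aᵢ ↔ Bᵢ}`. [folklore] -/
theorem PrL_cross_append_eq_measureReal_biInter {n : ℕ} (L : ℕ) (A B : Fin n → Set (Site 3)) :
    PrL (n + n) (Fin.append A B) (CROSS n) L =
      (μ L).real (⋂ i ∈ (Finset.univ : Finset (Fin n)),
        {ω | ∃ u v : BoxV 3 L, u.1 ∈ A i ∧ v.1 ∈ B i ∧ (openGraph ω).Reachable u v}) := by
  simp only [PrL, CROSS, Finset.mem_univ, iInter_true]
  congr 1
  ext ω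
  simp only [mem_setOf_eq, mem_iInter, Fin.append_left, Fin.append_right]

/-- **FKG in the box**: `∏ᵢ PrL[Aᵢ ↔ Bᵢ] ≤ PrL[CROSS (A ++ B)]`.
[cite: Grimmett2006, Thm. 3.8] -/
theorem prod_PrL_two_le_PrL_cross {n : ℕ} (L : ℕ) (A B : Fin n → Set (Site 3)) :
    ∏ i, PrL 2 ![A i, B i] {R | R 0 1} L ≤ PrL (n + n) (Fin.append A B) (CROSS n) L := by
  rw [PrL_cross_append_eq_measureReal_biInter]
  simp only [PrL_two_conn_eq_measureReal]
  exact fkg_prod_measureReal_le_biInter L Finset.univ _ fun i _ =>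
    isUpperSet_connEvent_box L (A i) (B i)

/-- **FKG in infinite volume**: for probe sets each finite or co-finite,
`∏ᵢ Pr[Aᵢ ↔ Bᵢ] ≤ Pr[CROSS (A ++ B)]` (the box inequality passed to the limit `L → ∞`,
`InvBook.tendsto_PrL`). [cite: Grimmett2006, Thm. 4.19] -/
theorem prod_Pr_two_le_Pr_cross {n : ℕ} (A B : Fin n → Set (Site 3))
    (hA : ∀ i, (A i).Finite ∨ (A i)ᶜ.Finite) (hB : ∀ i, (B i).Finite ∨ (B i)ᶜ.Finite) :
    ∏ i, Pr 2 ![A i, B i] {R | R 0 1} ≤ Pr (n + n) (Fin.append A B) (CROSS n) := by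
  have h2 : ∀ i, ∀ j : Fin 2, (![A i, B i] j).Finite ∨ (![A i, B i] j)ᶜ.Finite := fun i j => by
    fin_cases j
    · exact hA i
    · exact hB i
  have hAB : ∀ j, (Fin.append A B j).Finite ∨ (Fin.append A B j)ᶜ.Finite := fun j => by
    refine Fin.addCases (fun i => ?_) (fun i => ?_) j
    · simpa only [Fin.append_left] using hA i
    · simpa only [Fin.append_right] using hB i
  exact le_of_tendsto_of_tendsto'
    (tendsto_finsetProd _ fun i _ => InvBook.tendsto_PrL (h2 i) {R | R 0 1})
    (InvBook.tendsto_PrL hAB (CROSS n)) fun L => prod_PrL_two_le_PrL_cross L A B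

/-! ### §4 The stub -/

/-- **STUB `stub_fkgReduction` — two-ball positivity implies `CrossLawPositive`**: every generalised
ball with non-zero radius has non-empty interior, so each pair `(gball pᵢ, gball p_{n+i})` contains a
pair of disjoint closed balls `Aᵢ ⊆ gball pᵢ`, `Bᵢ ⊆ gball p_{n+i}` of positive radius; `Pr[CROSS]`
decreases when the probes shrink (`InvBook.Pr_mono_set`, `InvBook.cross_upward`); the CROSS event of
the shrunken family is the intersection of the `n` increasing events `{Aᵢ^δ ↔ Bᵢ^δ}`, so FKG
(`rcMeasure_fkg_holds`, iterated, then `L → ∞`) bounds it below by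
`∏ᵢ Pr[Aᵢ^δ ↔ Bᵢ^δ] ≥ ∏ᵢ cᵢ` eventually as `δ → 0⁺` (`Filter.eventually_all`).
[cite: Grimmett2006, Thm. 3.8] -/
theorem stub_fkgReduction :
    (∀ (a b : E3) (ra rb : ℝ), 0 < ra → 0 < rb →
        Disjoint (Metric.closedBall a ra) (Metric.closedBall b rb) →
        ∃ c : ℝ, 0 < c ∧ ∀ᶠ δ in 𝓝[>] (0:ℝ),
          c ≤ Pr 2 ![disc δ (Metric.closedBall a ra), disc δ (Metric.closedBall b rb)] {R | R 0 1}) →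
      CrossLawPositive := by
  intro H n p hp
  -- §1: disjoint closed sub-balls of each pair
  choose a b r hr hA hB hdisj using fun i : Fin n =>
    exists_disjoint_closedBalls_subset_gball (p (Fin.castAdd n i)) (p (Fin.natAdd n i))
      (hp _) (hp _)
  -- two-ball positivity for each pair
  choose c hc hev using fun i : Fin n => H (a i) (b i) (r i) (r i) (hr i) (hr i) (hdisj i)
  refine ⟨∏ i, c i, Finset.prod_pos fun i _ => hc i, ?_⟩
  have hall : ∀ᶠ δ in 𝓝[>] (0:ℝ), ∀ i, c i ≤
      Pr 2 ![disc δ (Metric.closedBall (a i) (r i)), disc δ (Metric.closedBall (b i) (r i))]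
        {R | R 0 1} :=
    eventually_all.2 hev
  have hpos : ∀ᶠ δ in 𝓝[>] (0:ℝ), 0 < δ := self_mem_nhdsWithin
  filter_upwards [hall, hpos] with δ hδall hδ
  -- finiteness of the probes at mesh `δ > 0`
  have hfa : ∀ i, (disc δ (Metric.closedBall (a i) (r i))).Finite ∨
      (disc δ (Metric.closedBall (a i) (r i)))ᶜ.Finite :=
    fun i => Or.inl (InvBook.finite_disc hδ Metric.isBounded_closedBall)
  have hfb : ∀ i, (disc δ (Metric.closedBall (b i) (r i))).Finite ∨
      (disc δ (Metric.closedBall (b i) (r i)))ᶜ.Finite :=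
    fun i => Or.inl (InvBook.finite_disc hδ Metric.isBounded_closedBall)
  have hfab : ∀ j, (Fin.append (fun i => disc δ (Metric.closedBall (a i) (r i)))
      (fun i => disc δ (Metric.closedBall (b i) (r i))) j).Finite ∨
      (Fin.append (fun i => disc δ (Metric.closedBall (a i) (r i)))
        (fun i => disc δ (Metric.closedBall (b i) (r i))) j)ᶜ.Finite := fun j => by
    refine Fin.addCases (fun i => ?_) (fun i => ?_) j
    · simpa only [Fin.append_left] using hfa i
    · simpa only [Fin.append_right] using hfb i
  -- §2: the sub-ball probes sit inside the generalised-ball probes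
  have hsub : ∀ j, Fin.append (fun i => disc δ (Metric.closedBall (a i) (r i)))
      (fun i => disc δ (Metric.closedBall (b i) (r i))) j ⊆ disc δ (gball (p j)) := fun j => by
    refine Fin.addCases (fun i => ?_) (fun i => ?_) j
    · rw [Fin.append_left]
      exact fun _ hx => hA i hx
    · rw [Fin.append_right]
      exact fun _ hx => hB i hx
  calc ∏ i, c i
      ≤ ∏ i, Pr 2 ![disc δ (Metric.closedBall (a i) (r i)), disc δ (Metric.closedBall (b i) (r i))]
          {R | R 0 1} := Finset.prod_le_prod (fun i _ => (hc i).le) fun i _ => hδall i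
    _ ≤ Pr (n + n) (Fin.append (fun i => disc δ (Metric.closedBall (a i) (r i)))
          (fun i => disc δ (Metric.closedBall (b i) (r i)))) (CROSS n) :=
        prod_Pr_two_le_Pr_cross _ _ hfa hfb
    _ ≤ Pr (n + n) (fun i => disc δ (gball (p i))) (CROSS n) :=
        InvBook.Pr_mono_set hfab (fun j => disc_gball_finite_or_cofinite hδ (p j)) hsub
          InvBook.cross_upward

end Summit.CriticalPhenomena.Ising3DConformalLimit.Cruxes.ArmDressingGlue.CrossPos

end
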